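import Literature.Probability.RandomPlanarGeometry.SLERestrictionLemmas
import Literature.Probability.RandomPlanarGeometry.HullApproximation
import HarnessLib

/-!
# The reflection `σ(z) = −z̄` of Loewner chains and slid hulls; [LSW] Lemma 6.2 for `A ∈ 𝒬₋`

Level 3 of the decomposition of `Literature.Probability.RandomPlanarGeometry.sle_restriction_eightThirds` ([LSW] Thm. 6.1; plan in
`SLERestrictionMartingale`), companion of `SLERestrictionLemmas`, after

* G. F. Lawler, O. Schramm, W. Werner, *Conformal restriction: the chordal case*, J. Amer. Math.
  Soc. **16** (2003) 917–955, arXiv:math/0209343 (**[LSW]**): §2 "Let `σ` denote the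
  orthogonal reflection about the imaginary axis, and let `𝒬₋ = {σ(A) : A ∈ 𝒬₊}`", and the
  proof of Thm. 6.1, "By symmetry, we may take `A ∈ 𝒬₊`".

[LSW] state Lemma 6.2 for `A ∈ 𝒬₊` and reduce the case `A ∈ 𝒬₋` to it "by symmetry". This file
makes the symmetry explicit and DETERMINISTIC (no symmetry of the SLE law is used): the
reflection `σ` (the tree's `Literature.Probability.RandomPlanarGeometry.imagAxisRefl`, `HullApproximation`, with its action on the hull
classes `IsBoundedHull/IsStarHull/IsPlusHull/IsMinusHull.image_imagAxisRefl` and on restriction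
MAPS of closed hulls, `IsRestrictionMap.reflectHull`) conjugates the chordal Loewner chain driven
by `W` to the chain driven by `−W` (the tree's `Loewner.IsSolution.neg_conj`,
`Loewner.swallowingTime_neg_conj`, `LoewnerChainProofs`), and carries closed hulls, slid hulls,
exit times and the NUMBERS `Φ'(0)` along. New here, all PROVED:

* `HasDerivWithinAt.imagAxisRefl_comp`, `DifferentiableOn.imagAxisRefl_comp` — complex
  differentiability WITHIN ARBITRARY SETS is preserved by `f ↦ σ ∘ f ∘ σ` (the algebra of the
  Schwarz reflection; the tree's `differentiableAt_imagAxisRefl_comp` is the open-set case),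
  whence the conjugate `ConformalEquiv.imagAxisConj` of a conformal equivalence between
  arbitrary sets and `ConformalEquiv.reflectSet : (ℍ ∖ B → ℍ) → (ℍ ∖ σ(B) → ℍ)` for an ARBITRARY
  `B` — needed for the slid hulls `A_t − W_t`, which are not known to be closed — with
  `IsRestrictionMap.reflectSet` and `HasRestrictionDeriv.reflectSet` (`Φ'_{σB}(0) = Φ'_B(0)`);
* `Loewner.map_imagAxisRefl`, `Loewner.hull_imagAxisRefl`, `Loewner.closedHull_imagAxisRefl`,
  `Loewner.slidHull_imagAxisRefl`, `Loewner.isExitTime_neg_iff` — the chain driven by `−W` is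
  the mirror image of the chain driven by `W`: `g^{−W}_t ∘ σ = σ ∘ g^W_t`, `K^{−W}_t = σ(K^W_t)`,
  same exit times `T(r)`;
* `Loewner.restrictionDeriv_exitTime_gt_of_isMinusHull` — **Lemma 6.2 for `A ∈ 𝒬₋`** from the
  named fact `Loewner.restrictionDeriv_exitTime_gt` (Lemma 6.2 for `𝒬₊`, `SLERestrictionLemmas`);
* `sle_restrictionDeriv_frequently_gt_of_isMinusHull`, `…_of_isPlusHull_or_isMinusHull` — the
  property `sle_restrictionDeriv_frequently_gt A` of `SLERestrictionMartingale` (hypothesis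
  `h62` of `sle_restriction_eightThirds_of_limits`) for every `A ∈ 𝒬₊ ∪ 𝒬₋`, in particular for
  every smooth `*`-hull ([LSW] §2: "Any smooth hull in `𝒬*` is in `𝒬₊ ∪ 𝒬₋`"), given Lemma 6.2
  and the Rohde–Schramm / Lawler facts used in `SLERestrictionLemmas`.

Mathlib: `hasDerivWithinAt_iff_isLittleO`, `Asymptotics`, `Metric.cobounded_eq_cocompact`.
-/

noncomputable section

open Set Filter Topology Metric Complex Asymptotics
open UpperHalfPlane (upperHalfPlaneSet isOpen_upperHalfPlaneSet)
open scoped NNReal ComplexConjugate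

namespace Literature.Probability.RandomPlanarGeometry

/-! ### Complements on the reflection `σ = imagAxisRefl` -/

/-- `σ` is additive (subtraction). [folklore] -/
theorem imagAxisRefl_sub (z w : ℂ) : imagAxisRefl (z - w) = imagAxisRefl z - imagAxisRefl w := by
  simp [map_sub]; ring

/-- `σ(ℍ) = ℍ`, preimage form. [folklore] -/
@[simp] theorem imagAxisRefl_preimage_upperHalfPlaneSet :
    imagAxisRefl ⁻¹' upperHalfPlaneSet = upperHalfPlaneSet := by
  rw [imagAxisRefl_preimage, imagAxisRefl_image_upperHalfPlaneSet]

/-- `σ⁻¹(ℍ ∖ B) = ℍ ∖ σ(B)`. [folklore] -/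
theorem imagAxisRefl_preimage_diff (B : Set ℂ) :
    imagAxisRefl ⁻¹' (upperHalfPlaneSet \ B) = upperHalfPlaneSet \ imagAxisRefl '' B := by
  rw [preimage_sdiff, imagAxisRefl_preimage_upperHalfPlaneSet, imagAxisRefl_preimage]

/-- `σ` preserves the cocompact filter. [folklore] -/
theorem tendsto_imagAxisRefl_cocompact : Tendsto imagAxisRefl (cocompact ℂ) (cocompact ℂ) :=
  imagAxisRefl.toCocompactMap.cocompact_tendsto'

/-- The ratio of the reflected map is the conjugate of the ratio: `σ(a)/z = conj(a/σ(z))`.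
[folklore] -/
theorem imagAxisRefl_div_eq (a z : ℂ) : imagAxisRefl a / z = conj (a / imagAxisRefl z) := by
  simp only [imagAxisRefl_apply, map_div₀, map_neg, Complex.conj_conj]
  rw [neg_div, div_neg]

/-! ### Complex differentiability within sets is preserved by conjugation with `σ` -/

/-- If `f` has derivative `f'` within `s` at `σ w`, then `σ ∘ f ∘ σ` has derivative `conj f'`
within `σ⁻¹(s)` at `w` (Schwarz-reflection algebra, within arbitrary sets). [folklore] -/
theorem HasDerivWithinAt.imagAxisRefl_comp {f : ℂ → ℂ} {f' : ℂ} {s : Set ℂ} {w : ℂ}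
    (hf : HasDerivWithinAt f f' s (imagAxisRefl w)) :
    HasDerivWithinAt (fun z ↦ imagAxisRefl (f (imagAxisRefl z))) (conj f') (imagAxisRefl ⁻¹' s)
      w := by
  rw [hasDerivWithinAt_iff_isLittleO] at hf ⊢
  have ht : Tendsto imagAxisRefl (𝓝[imagAxisRefl ⁻¹' s] w) (𝓝[s] (imagAxisRefl w)) :=
    tendsto_nhdsWithin_iff.2 ⟨(imagAxisRefl.continuous.tendsto w).mono_left nhdsWithin_le_nhds,
      eventually_nhdsWithin_of_forall fun z hz ↦ hz⟩
  have h1 := hf.comp_tendsto ht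
  have h2 : (fun z ↦ imagAxisRefl z - imagAxisRefl w) =O[𝓝[imagAxisRefl ⁻¹' s] w]
      fun z ↦ z - w :=
    isBigO_of_le _ fun z ↦ by rw [← imagAxisRefl_sub, norm_imagAxisRefl]
  have h3 := h1.trans_isBigO h2
  have key : ∀ z, imagAxisRefl (f (imagAxisRefl z)) - imagAxisRefl (f (imagAxisRefl w)) -
      (z - w) • conj f' = imagAxisRefl (f (imagAxisRefl z) - f (imagAxisRefl w) -
        (imagAxisRefl z - imagAxisRefl w) • f') := fun z ↦ by
    simp only [imagAxisRefl_apply, smul_eq_mul, map_sub, map_mul, map_neg, Complex.conj_conj]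
    ring
  rw [← isLittleO_norm_left] at h3 ⊢
  refine h3.congr_left fun z ↦ ?_
  rw [Function.comp_apply, key, norm_imagAxisRefl]

/-- Complex differentiability on an arbitrary set transfers along conjugation by `σ`.
[folklore] -/
theorem DifferentiableOn.imagAxisRefl_comp {f : ℂ → ℂ} {s : Set ℂ}
    (hf : DifferentiableOn ℂ f s) :
    DifferentiableOn ℂ (fun z ↦ imagAxisRefl (f (imagAxisRefl z))) (imagAxisRefl ⁻¹' s) :=
  fun w hw ↦ (HasDerivWithinAt.imagAxisRefl_comp
    (hf (imagAxisRefl w) hw).hasDerivWithinAt).differentiableWithinAt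

/-! ### Conjugating a conformal equivalence between arbitrary sets by `σ` -/

namespace ConformalEquiv

variable {U V : Set ℂ}

/-- The conjugate `σ ∘ φ ∘ σ : σ(U) → σ(V)` of a conformal equivalence `φ : U → V` between
ARBITRARY sets (written as preimages; the tree's `ConformalEquiv.reflect` is the case of open
`U`, `V`). [folklore] -/
def imagAxisConj (φ : ConformalEquiv U V) :
    ConformalEquiv (imagAxisRefl ⁻¹' U) (imagAxisRefl ⁻¹' V) where
  toFun z := imagAxisRefl (φ (imagAxisRefl z))
  invFun w := imagAxisRefl (φ.symm (imagAxisRefl w))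
  source := imagAxisRefl ⁻¹' U
  target := imagAxisRefl ⁻¹' V
  map_source' z hz := by
    show imagAxisRefl (imagAxisRefl (φ (imagAxisRefl z))) ∈ V
    rw [imagAxisRefl_imagAxisRefl]; exact φ.mapsTo hz
  map_target' w hw := by
    show imagAxisRefl (imagAxisRefl (φ.symm (imagAxisRefl w))) ∈ U
    rw [imagAxisRefl_imagAxisRefl]; exact φ.symm_mapsTo hw
  left_inv' z hz := by
    show imagAxisRefl (φ.symm (imagAxisRefl (imagAxisRefl (φ (imagAxisRefl z))))) = z
    rw [imagAxisRefl_imagAxisRefl, φ.symm_apply_apply hz, imagAxisRefl_imagAxisRefl]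
  right_inv' w hw := by
    show imagAxisRefl (φ (imagAxisRefl (imagAxisRefl (φ.symm (imagAxisRefl w))))) = w
    rw [imagAxisRefl_imagAxisRefl, φ.apply_symm_apply hw, imagAxisRefl_imagAxisRefl]
  source_eq := rfl
  target_eq := rfl
  differentiableOn := DifferentiableOn.imagAxisRefl_comp φ.differentiableOn
  differentiableOn_symm := DifferentiableOn.imagAxisRefl_comp φ.symm.differentiableOn

/-- The conjugated equivalence is `σ ∘ φ ∘ σ`. [folklore] -/
@[simp] theorem imagAxisConj_apply (φ : ConformalEquiv U V) (z : ℂ) :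
    φ.imagAxisConj z = imagAxisRefl (φ (imagAxisRefl z)) := rfl

end ConformalEquiv

/-! ### Reflecting restriction data of an arbitrary `B ⊆ ℂ` -/

section Restriction

variable {B : Set ℂ}

/-- The reflection of a restriction map of `B`, as a map `ℍ ∖ σ(B) → ℍ`, for an ARBITRARY `B`
(the tree's `ConformalEquiv.reflectHull` asks `B` closed). [folklore] -/
def ConformalEquiv.reflectSet (Φ : ConformalEquiv (upperHalfPlaneSet \ B) upperHalfPlaneSet) :
    ConformalEquiv (upperHalfPlaneSet \ imagAxisRefl '' B) upperHalfPlaneSet :=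
  Φ.imagAxisConj.copy _ _ (imagAxisRefl_preimage_diff B).symm
    imagAxisRefl_preimage_upperHalfPlaneSet.symm

/-- The reflected restriction map is `σ ∘ Φ ∘ σ`. [folklore] -/
@[simp] theorem ConformalEquiv.reflectSet_apply
    (Φ : ConformalEquiv (upperHalfPlaneSet \ B) upperHalfPlaneSet) (z : ℂ) :
    Φ.reflectSet z = imagAxisRefl (Φ (imagAxisRefl z)) := rfl

/-- `σ` maps `𝓝[ℍ ∖ σ(B)] 0` to `𝓝[ℍ ∖ B] 0`. [folklore] -/
theorem tendsto_imagAxisRefl_nhdsWithin_diff (B : Set ℂ) :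
    Tendsto imagAxisRefl (𝓝[upperHalfPlaneSet \ imagAxisRefl '' B] 0)
      (𝓝[upperHalfPlaneSet \ B] 0) := by
  rw [← imagAxisRefl_image_diff]
  exact tendsto_imagAxisRefl_nhdsWithin _

/-- `σ` maps `∞` within `ℍ ∖ σ(B)` to `∞` within `ℍ ∖ B`. [folklore] -/
theorem tendsto_imagAxisRefl_cocompact_diff (B : Set ℂ) :
    Tendsto imagAxisRefl (cocompact ℂ ⊓ 𝓟 (upperHalfPlaneSet \ imagAxisRefl '' B))
      (cocompact ℂ ⊓ 𝓟 (upperHalfPlaneSet \ B)) := by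
  rw [← imagAxisRefl_image_diff]
  exact tendsto_imagAxisRefl_cocompact_inf _

/-- **Restriction maps reflect** (arbitrary `B`): if `Φ` is a restriction map of `B`, its
reflection is a restriction map of `σ(B)` (cf. `IsRestrictionMap.reflectHull` for closed `B`).
[folklore] -/
theorem IsRestrictionMap.reflectSet {Φ : ConformalEquiv (upperHalfPlaneSet \ B) upperHalfPlaneSet}
    (h : IsRestrictionMap B Φ) : IsRestrictionMap (imagAxisRefl '' B) Φ.reflectSet := by
  refine ⟨?_, ?_⟩
  · -- boundary value `0` at `0`
    change Tendsto (fun z ↦ imagAxisRefl (Φ (imagAxisRefl z))) _ _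
    have := (imagAxisRefl.continuous.tendsto 0).comp
      (h.1.comp (tendsto_imagAxisRefl_nhdsWithin_diff B))
    simpa [Function.comp_def] using this
  · change Tendsto (fun z ↦ imagAxisRefl (Φ (imagAxisRefl z)) / z) _ _
    have h2 := (Complex.continuous_conj.tendsto 1).comp
      (h.2.comp (tendsto_imagAxisRefl_cocompact_diff B))
    simp only [map_one] at h2
    refine h2.congr' (Eventually.of_forall fun z ↦ ?_)
    simp only [Function.comp_apply, imagAxisRefl_div_eq]

/-- **The number `Φ'(0)` is reflection invariant**: `Φ'_{σB}(0) = Φ'_B(0)`. [folklore] -/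
theorem HasRestrictionDeriv.reflectSet
    {Φ : ConformalEquiv (upperHalfPlaneSet \ B) upperHalfPlaneSet} {d : ℝ}
    (h : HasRestrictionDeriv B Φ d) : HasRestrictionDeriv (imagAxisRefl '' B) Φ.reflectSet d := by
  change Tendsto (fun z ↦ imagAxisRefl (Φ (imagAxisRefl z)) / z) _ _
  have h2 := (Complex.continuous_conj.tendsto (d : ℂ)).comp
    (h.comp (tendsto_imagAxisRefl_nhdsWithin_diff B))
  rw [Complex.conj_ofReal] at h2
  refine h2.congr' (Eventually.of_forall fun z ↦ ?_)
  simp only [Function.comp_apply, imagAxisRefl_div_eq]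

/-- Restriction data of `B` from restriction data of a set `B'` with `σ(B') = B` (transport
along the set equality; used with `B' = σ(B)`). [folklore] -/
theorem exists_restrictionData_of_image {B B' : Set ℂ} (hB : imagAxisRefl '' B' = B)
    (Ψ : ConformalEquiv (upperHalfPlaneSet \ B') upperHalfPlaneSet) {e : ℝ}
    (hΨ : IsRestrictionMap B' Ψ) (he : HasRestrictionDeriv B' Ψ e) :
    ∃ Ψ' : ConformalEquiv (upperHalfPlaneSet \ B) upperHalfPlaneSet,
      IsRestrictionMap B Ψ' ∧ HasRestrictionDeriv B Ψ' e := by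
  subst hB
  exact ⟨Ψ.reflectSet, hΨ.reflectSet, he.reflectSet⟩

end Restriction

/-! ### Reflecting the Loewner flow: the chain driven by `−W` -/

namespace Loewner

variable {W : ℝ≥0 → ℝ} {z : ℂ} {g : ℝ → ℂ} {T : WithTop ℝ≥0}

/-- **Reflection of solutions of the Loewner equation** — the tree's `IsSolution.neg_conj`
(`LoewnerChainProofs`) written with `σ = imagAxisRefl`: if `g` solves the equation driven by
`W` from `z`, then `σ ∘ g` solves the equation driven by `−W` from `σ z`. [folklore] -/
theorem IsSolution.imagAxisRefl (h : IsSolution W z g T) :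
    IsSolution (fun s ↦ -W s) (Literature.Probability.RandomPlanarGeometry.imagAxisRefl z) (fun t ↦ Literature.Probability.RandomPlanarGeometry.imagAxisRefl (g t)) T :=
  h.neg_conj

/-- Converse reflection (apply `IsSolution.imagAxisRefl` to the reflected data). [folklore] -/
theorem IsSolution.of_imagAxisRefl {g' : ℝ → ℂ}
    (h : IsSolution (fun s ↦ -W s) (Literature.Probability.RandomPlanarGeometry.imagAxisRefl z) g' T) :
    IsSolution W z (fun t ↦ Literature.Probability.RandomPlanarGeometry.imagAxisRefl (g' t)) T := by
  have := h.imagAxisRefl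
  simpa only [neg_neg, imagAxisRefl_imagAxisRefl] using this

/-- **Swallowing times are reflection invariant** — the tree's `swallowingTime_neg_conj`
written with `σ`: `T_{σz}` for `−W` equals `T_z` for `W`. [folklore] -/
theorem swallowingTime_imagAxisRefl (W : ℝ≥0 → ℝ) (z : ℂ) :
    swallowingTime (fun s ↦ -W s) (Literature.Probability.RandomPlanarGeometry.imagAxisRefl z) = swallowingTime W z :=
  swallowingTime_neg_conj W z

/-- **The Loewner map reflects**: `g^{−W}_t(σ z) = σ(g^W_t(z))` (continuous `W`). [folklore] -/
theorem map_imagAxisRefl (hW : Continuous W) (t : ℝ≥0) (z : ℂ) :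
    map (fun s ↦ -W s) t (Literature.Probability.RandomPlanarGeometry.imagAxisRefl z) = Literature.Probability.RandomPlanarGeometry.imagAxisRefl (map W t z) := by
  classical
  by_cases h : ∃ p : (ℝ → ℂ) × WithTop ℝ≥0, IsSolution W z p.1 p.2 ∧ (t : WithTop ℝ≥0) < p.2
  · obtain ⟨⟨g, T⟩, hg, ht⟩ := h
    rw [map_eq_of_isSolution hW hg ht,
      map_eq_of_isSolution (W := fun s ↦ -W s) hW.neg hg.imagAxisRefl ht]
  · have h' : ¬ ∃ p : (ℝ → ℂ) × WithTop ℝ≥0,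
        IsSolution (fun s ↦ -W s) (Literature.Probability.RandomPlanarGeometry.imagAxisRefl z) p.1 p.2 ∧ (t : WithTop ℝ≥0) < p.2 := by
      rintro ⟨⟨g', T'⟩, hg', ht'⟩
      exact h ⟨⟨_, T'⟩, hg'.of_imagAxisRefl, ht'⟩
    rw [map, dif_neg h', map, dif_neg h]

/-- **Hulls reflect**: `K^{−W}_t = σ(K^W_t)` (cf. `hull_neg` of `LoewnerMapProofs`, the same
identity for the bare map `z ↦ -z̄`). [folklore] -/
theorem hull_imagAxisRefl (W : ℝ≥0 → ℝ) (t : ℝ≥0) :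
    hull (fun s ↦ -W s) t = Literature.Probability.RandomPlanarGeometry.imagAxisRefl '' hull W t := by
  rw [← imagAxisRefl_preimage]
  ext z
  simp only [hull, mem_setOf_eq, mem_preimage, upperHalfPlaneSet, imagAxisRefl_im]
  rw [← swallowingTime_imagAxisRefl W (Literature.Probability.RandomPlanarGeometry.imagAxisRefl z)]
  simp only [imagAxisRefl_imagAxisRefl]

/-- **Closed hulls reflect**: `K̄^{−W}_t = σ(K̄^W_t)`. [folklore] -/
theorem closedHull_imagAxisRefl (W : ℝ≥0 → ℝ) (t : ℝ≥0) :
    closedHull (fun s ↦ -W s) t = Literature.Probability.RandomPlanarGeometry.imagAxisRefl '' closedHull W t := by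
  rw [← imagAxisRefl_preimage]
  ext z
  simp only [closedHull, mem_setOf_eq, mem_preimage, imagAxisRefl_im]
  rw [← swallowingTime_imagAxisRefl W (Literature.Probability.RandomPlanarGeometry.imagAxisRefl z), imagAxisRefl_imagAxisRefl]

/-- **Slid hulls reflect**: `(σA)^{−W}_t − (−W_t) = σ(A_t − W_t)`. [folklore] -/
theorem slidHull_imagAxisRefl (hW : Continuous W) (A : Set ℂ) (t : ℝ≥0) :
    slidHull (fun s ↦ -W s) (Literature.Probability.RandomPlanarGeometry.imagAxisRefl '' A) t = Literature.Probability.RandomPlanarGeometry.imagAxisRefl '' slidHull W A t := by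
  rw [slidHull, slidHull, image_image, image_image]
  refine image_congr fun a _ ↦ ?_
  rw [map_imagAxisRefl hW, imagAxisRefl_sub, imagAxisRefl_ofReal, Complex.ofReal_neg]

/-- A set lies in the disc `r𝕌` iff its reflection does. [folklore] -/
theorem imagAxisRefl_image_subset_ball_iff {K : Set ℂ} {r : ℝ} :
    Literature.Probability.RandomPlanarGeometry.imagAxisRefl '' K ⊆ ball 0 r ↔ K ⊆ ball 0 r := by
  constructor
  · intro h z hz
    have := h (mem_image_of_mem _ hz)
    simpa [mem_ball, dist_zero_right] using this
  · rintro h _ ⟨z, hz, rfl⟩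
    have := h hz
    simpa [mem_ball, dist_zero_right] using this

/-- **Exit times are reflection invariant**: `T(r)` is the same for `W` and `−W`. [folklore] -/
theorem isExitTime_neg_iff {r : ℝ} {t : ℝ≥0} :
    IsExitTime (fun s ↦ -W s) r t ↔ IsExitTime W r t := by
  simp only [IsExitTime, closedHull_imagAxisRefl, imagAxisRefl_image_subset_ball_iff]

variable {A : Set ℂ}

/-- **[LSW] Lemma 6.2 for `A ∈ 𝒬₋`, by symmetry** (proof of Thm. 6.1: "By symmetry, we may
take `A ∈ 𝒬₊`"): the reflection `σ` carries the chain driven by `W` and the hull `A ∈ 𝒬₋` to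
the chain driven by `−W` and `σ(A) ∈ 𝒬₊`, preserving closed hulls, exit times, slid hulls and
the numbers `Φ'(0)`; so the named fact `restrictionDeriv_exitTime_gt` (Lemma 6.2, hypothesis
`h62`) transfers.
[cite: LawlerSchrammWerner2003Restriction, Lemma 6.2 and proof of Thm. 6.1 ("By symmetry")] -/
theorem restrictionDeriv_exitTime_gt_of_isMinusHull (h62 : restrictionDeriv_exitTime_gt)
    (hW : Continuous W) (hA : IsMinusHull A) (hdisj : ∀ t, Disjoint (closedHull W t) A)
    {ε : ℝ} (hε : 0 < ε) :
    ∃ r₀ : ℝ, ∀ r : ℝ, r₀ ≤ r → ∀ t : ℝ≥0, IsExitTime W r t →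
      ∀ (Ψ : ConformalEquiv (upperHalfPlaneSet \ slidHull W A t) upperHalfPlaneSet) (e : ℝ),
        IsRestrictionMap (slidHull W A t) Ψ → HasRestrictionDeriv (slidHull W A t) Ψ e →
          1 - ε < e := by
  have hdisj' : ∀ t, Disjoint (closedHull (fun s ↦ -W s) t) (Literature.Probability.RandomPlanarGeometry.imagAxisRefl '' A) := fun t ↦ by
    rw [closedHull_imagAxisRefl]
    exact (disjoint_image_iff imagAxisRefl.injective).2 (hdisj t)
  obtain ⟨r₀, hr₀⟩ := h62 hW.neg hA.image_imagAxisRefl hdisj' ε hε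
  refine ⟨r₀, fun r hr t ht Ψ e hΨ he ↦ ?_⟩
  obtain ⟨Ψ', hΨ', he'⟩ :=
    exists_restrictionData_of_image (slidHull_imagAxisRefl hW A t).symm Ψ hΨ he
  exact hr₀ r hr t (isExitTime_neg_iff.2 ht) Ψ' e hΨ' he'

end Loewner

/-! ### [LSW] Lemma 6.2 for SLE_{8/3}: `h62` for `A ∈ 𝒬₋` and for `A ∈ 𝒬₊ ∪ 𝒬₋` -/

section SLE

variable {A : Set ℂ}

/-- **[LSW] Lemma 6.2 for SLE_{8/3} and `A ∈ 𝒬₋`** (by symmetry): the property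
`sle_restrictionDeriv_frequently_gt A`, exactly as for `𝒬₊`
(`sle_restrictionDeriv_frequently_gt_of_isPlusHull`), from the reflected Lemma 6.2.
[cite: LawlerSchrammWerner2003Restriction, Lemma 6.2 and proof of Thm. 6.1 (§6)] -/
theorem sle_restrictionDeriv_frequently_gt_of_isMinusHull
    (h62 : Loewner.restrictionDeriv_exitTime_gt) (hgen : HasSLETrace ((8 : ℝ≥0) / 3))
    (h₆ : RandomPlanarGeometry.ae_isSimpleTrace_sleTrace_of_le_four (κ := (8 : ℝ≥0) / 3))
    (htr : tendsto_norm_sleTrace_atTop) (hswallow : sle_swallowingTime_ofReal_eq_firstHit)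
    (hA : IsMinusHull A) : sle_restrictionDeriv_frequently_gt A := by
  have hκ0 : (0 : ℝ≥0) < 8 / 3 := by positivity
  have hκ4 : (8 : ℝ≥0) / 3 ≤ 4 := by
    rw [div_le_iff₀ (by norm_num : (0 : ℝ≥0) < 3)]
    norm_num
  filter_upwards [ae_isGeneratedByCurve_sleTrace hgen, h₆ hκ0 hκ4, htr hκ0] with ω hgenω hsω htrω
    hT ε hε
  have hdisj : ∀ t, Disjoint (Loewner.closedHull (sleDriving ((8 : ℝ≥0) / 3) ω) t) A :=
    disjoint_closedHull hswallow hgenω hsω (firstHit_eq_top_iff_disjoint.1 hT)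
  obtain ⟨r₀, hr₀⟩ := Loewner.restrictionDeriv_exitTime_gt_of_isMinusHull h62
    (continuous_sleDriving _ ω) hA hdisj hε
  rw [frequently_atTop]
  intro a
  obtain ⟨r, hr, t, hat, ht⟩ := exists_isExitTime_ge hswallow hgenω hsω htrω a r₀
  exact ⟨t, hat, hr₀ r hr t ht⟩

/-- **[LSW] Lemma 6.2 for SLE_{8/3} and `A ∈ 𝒬₊ ∪ 𝒬₋`** — in particular for every smooth
`*`-hull ([LSW] §2: "Any smooth hull in `𝒬*` is in `𝒬₊ ∪ 𝒬₋`"): the hypothesis `h62` of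
`sle_restriction_eightThirds_of_limits` (`SLERestrictionMartingale`) on that class.
[cite: LawlerSchrammWerner2003Restriction, Lemma 6.2 and proof of Thm. 6.1 (§6)] -/
theorem sle_restrictionDeriv_frequently_gt_of_isPlusHull_or_isMinusHull
    (h62 : Loewner.restrictionDeriv_exitTime_gt) (hgen : HasSLETrace ((8 : ℝ≥0) / 3))
    (h₆ : RandomPlanarGeometry.ae_isSimpleTrace_sleTrace_of_le_four (κ := (8 : ℝ≥0) / 3))
    (htr : tendsto_norm_sleTrace_atTop) (hswallow : sle_swallowingTime_ofReal_eq_firstHit)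
    (hA : IsPlusHull A ∨ IsMinusHull A) : sle_restrictionDeriv_frequently_gt A :=
  hA.elim (sle_restrictionDeriv_frequently_gt_of_isPlusHull h62 hgen h₆ htr hswallow)
    (sle_restrictionDeriv_frequently_gt_of_isMinusHull h62 hgen h₆ htr hswallow)

end SLE

end Literature.Probability.RandomPlanarGeometry

end
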